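/-
Copyright (c) 2026 the pub-hodgecm-mathlib formalisation cell (harness21).  Prover seat hodgecm-mathlib-K2E3-p17 (g8), Track B «K2-LIT» ∕ h413
(`stmt-HodgeConjecture-24833`), line `K2_E3_EllipticInputs`, leaf (nsc-S-A′), H-layer brick LEV-3 = rule (lev) of `MEMO-H4-residues.v1.K2E3-p25-g0.md` §1 (architect
K2E3-p25 (g0); dealer K2E3-plan (g4) RULINGS #3 (R-9) D76).  2026-09-04.
-/
import Summits.HodgeConjecture.HodgeConjecture.Theorems.K2E3GL3DegenerateUnipotentTrivial     -- LEV-3 core (this seat): `U_Q` acts trivially on a `ψ_nd`+`ψ′`-degenerate smooth representation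
import Literature.NumberTheory.Automorphic.MatrixCoefficientsSupercuspidalAdmissibleProofs      -- ★ Schur: `IsIrreducible.exists_eq_smul_id_of_rank_le_aleph0`, `IsSmooth.rank_le_aleph0`, `countable_quotient_of_isOpen_of_sigmaCompactSpace`
import HarnessLib

/-!
# Crux `H413` — K2-LIT E3, H-layer rule (lev): a `ψ_nd`- and `ψ′`-DEGENERATE irreducible smooth representation of `GL₃(F)` is ONE-DIMENSIONAL (so `dim r_B = 1`)

Cell `hodgecm-mathlib`, Track B, line `K2_E3_EllipticInputs`, leaf (nsc-S-A′) `sig_K2E3GL3PrincipalBlockStandardSpan`; H-layer rule (lev) of the architect's memo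
`MEMO-H4-residues.v1` §1 (K2E3-p25 (g0)): **`ω` irreducible smooth, `ω_{U₃,ψ_nd} = 0`, `ω_{U₃,ψ′} = 0` (`ψ′(u) = ψ(u₁₂)`) ⟹ `ω` is one-dimensional, in particular
`dim r_B(ω) = 1`** — Bernstein–Zelevinsky's «the highest derivative of a degenerate representation» argument ([BZ-I] 4.7, [Z-II] 4.3) at `n = 3` without the derivative
formalism.  THEOREMS ONLY; count-neutral helper (`--supports stmt-HodgeConjecture-24833 --as helper`).

PROOF (continuing ★ core `K2E3GL3DegenerateUnipotentTrivial`: `U_Q` acts trivially).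
* §1 every TRANSVECTION acts trivially: `T₀₂, T₁₂ ∈ U_Q`; every `T_{ij}` is `P_σ T₀₂ P_σ⁻¹` for a permutation matrix (★ `permGL_mul_transvectionGL_mul_inv`);
* §2 transvections and diagonal matrices generate `GL₃` (Mathlib `Matrix.diagonal_transvection_induction_of_det_ne_zero`), so `ω(g) = ω(diag d_g)` and ALL `ω(g)`
  COMMUTE (the diagonal torus is abelian) — no `SL₃`∕determinant argument needed;
* §3 Schur in countable dimension (★ `IsIrreducible.exists_eq_smul_id_of_rank_le_aleph0`, `GL₃(F)` σ-compact): every `ω(g)` is a scalar, every subspace is invariant,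
  irreducibility makes `V` a line: **`finrank_eq_one_of_degenerate`**; and `U₃ = U_Q·U_{α₁}` acts trivially, so the Borel Jacquet module is all of `V`:
  **`ker_restrictUnipotentGL_eq_bot_of_degenerate`**, **`finrank_coinvariants_restrictUnipotentGL_eq_one_of_degenerate`** (`dim r_B ω = 1` in ★ `jacquetGL` currency).
Hypotheses in the tree's vocabulary: `hnd : ∀ v, Coinvariants.mk (whittakerTwist ω ψ) v = 0` («`ω_{U₃,ψ_nd} = 0`», ★ `twistedJacquet`) and, for a character `θ′` of `U₃`
with `θ′(u) = ψ(u₁₂)` (given as data + letter), `hdeg′ : ∀ v, Coinvariants.mk (ω.charTwist U₃ θ′) v = 0` («`ω_{U₃,ψ′} = 0`»).  No admissibility is needed.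

HONEST LABEL: HC_CM is proved only modulo the 7 printed citations (2 remaining named inputs: hLiu418 = stmt-HodgeConjecture-24832, h413 =
stmt-HodgeConjecture-24833) until rung 0 closes; count-neutral helper (consumed by the H-layer H2, config C1, of leaf (nsc-S-A′)).

## References
* [BernsteinZelevinskyASENS1977] I. N. Bernstein, A. V. Zelevinsky, *Induced representations of reductive p-adic groups I*, Ann. Sci. ÉNS 10 (1977), Thm. 4.7.
* [Zelevinsky1980] A. V. Zelevinsky, *Induced representations of reductive p-adic groups II*, Ann. Sci. ÉNS 13 (1980), 4.3.
* [BernsteinZelevinsky1976] I. N. Bernstein, A. V. Zelevinsky, Russian Math. Surveys 31:3 (1976), 2.11 (Schur's lemma in countable dimension).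
-/

set_option autoImplicit false
-- the mandated namespace repeats `HodgeConjecture.HodgeConjecture`, as in every `Theorems/*.lean` of this sub-problem
set_option linter.dupNamespace false

noncomputable section

open Representation Matrix Literature.NumberTheory.Automorphic Literature.NumberTheory.GaloisRepresentations.IsNonarchimedeanLocalField
open scoped MatrixGroups
open Summit.HodgeConjecture.HodgeConjecture.Cruxes.H413.K2E3GL3UnipotentCharacters
open Summit.HodgeConjecture.HodgeConjecture.Cruxes.H413.K2E3GL3DegenerateUnipotentTrivial

namespace Summit.HodgeConjecture.HodgeConjecture.Cruxes.H413.K2E3GL3DegenerateLevelOne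

variable {F : Type*} [Field F] [ValuativeRel F] [TopologicalSpace F] [IsNonarchimedeanLocalField F]
  {ψ : AddChar F Circle} {V : Type*} [AddCommGroup V] [Module ℂ V] (ω : Representation ℂ (GL (Fin 3) F) V)

/-! ## §1 Transvections act trivially -/

section Transvections

omit [ValuativeRel F] [TopologicalSpace F] [IsNonarchimedeanLocalField F] in
/-- For `i ≠ j` in `Fin 3` there is a permutation with `σ 0 = i`, `σ 2 = j`. [folklore] -/
theorem exists_perm_apply_eq (i j : Fin 3) (hij : i ≠ j) : ∃ σ : Equiv.Perm (Fin 3), σ 0 = i ∧ σ 2 = j := by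
  revert i j
  decide

omit [ValuativeRel F] [TopologicalSpace F] [IsNonarchimedeanLocalField F] in
/-- **Every transvection acts trivially** on a representation on which `U_Q` acts trivially: `T₀₂ ∈ U_Q`, and `T_{ij} = P_σ T₀₂ P_σ⁻¹`. [cite: BernsteinZelevinskyASENS1977, Thm. 4.7] -/
theorem apply_transvectionGL_eq_self (hN : ∀ n ∈ unipotentRadicalGL F ![false, false, true], ∀ v : V, ω n v = v)
    {i j : Fin 3} (hij : i ≠ j) (c : F) (v : V) : ω (transvectionGL i j hij c) v = v := by
  obtain ⟨σ, hσi, hσj⟩ := exists_perm_apply_eq i j hij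
  have h02 : (0 : Fin 3) ≠ 2 := by decide
  -- `P T₀₂ P⁻¹ = T_{σ⁻¹⁻¹ 0, …}`: use `σ⁻¹` so that `(σ⁻¹)⁻¹ = σ`
  have hconj := permGL_mul_transvectionGL_mul_inv (K := F) σ⁻¹ h02 c
  have hT : transvectionGL i j hij c = permGL σ⁻¹ * transvectionGL (0 : Fin 3) 2 h02 c * (permGL σ⁻¹)⁻¹ := by
    rw [hconj]
    subst hσi hσj
    rfl
  have hmem : transvectionGL (0 : Fin 3) 2 h02 c ∈ unipotentRadicalGL F ![false, false, true] := transvectionGL_mem_unipotentRadicalGL _ (by decide) c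
  rw [hT, map_mul, map_mul, Module.End.mul_apply, Module.End.mul_apply, hN _ hmem, ← Module.End.mul_apply, ← map_mul, mul_inv_cancel, map_one,
    Module.End.one_apply]

omit [ValuativeRel F] [TopologicalSpace F] [IsNonarchimedeanLocalField F] in
/-- **`ω(G) ⊆ ω(T)`**: if every transvection acts trivially then every `ω(g)` equals `ω(d)` for a diagonal `d` (transvections and diagonal matrices generate `GL₃`,
Mathlib `diagonal_transvection_induction_of_det_ne_zero`). [cite: BernsteinZelevinskyASENS1977, Thm. 4.7] -/
theorem exists_diagonalGL_apply_eq (hT : ∀ (i j : Fin 3) (hij : i ≠ j) (c : F), ω (transvectionGL i j hij c) = 1) (g : GL (Fin 3) F) :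
    ∃ d : Fin 3 → Fˣ, ω g = ω (diagonalGL (Fin 3) F d) := by
  suffices h : ∀ M : Matrix (Fin 3) (Fin 3) F, M.det ≠ 0 → ∃ g' : GL (Fin 3) F, (g' : Matrix (Fin 3) (Fin 3) F) = M ∧ ∃ d : Fin 3 → Fˣ, ω g' = ω (diagonalGL (Fin 3) F d) by
    obtain ⟨g', hg', d, hd⟩ := h g (Matrix.GeneralLinearGroup.det_ne_zero g)
    have : g' = g := Units.ext hg'
    exact ⟨d, this ▸ hd⟩
  intro M hM
  refine Matrix.diagonal_transvection_induction_of_det_ne_zero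
    (fun M => ∃ g' : GL (Fin 3) F, (g' : Matrix (Fin 3) (Fin 3) F) = M ∧ ∃ d : Fin 3 → Fˣ, ω g' = ω (diagonalGL (Fin 3) F d)) M hM ?_ ?_ ?_
  · intro D hDdet
    rw [Matrix.det_diagonal, Finset.prod_ne_zero_iff] at hDdet
    refine ⟨diagonalGL (Fin 3) F fun i => Units.mk0 (D i) (hDdet i (Finset.mem_univ i)), ?_, _, rfl⟩
    rw [coe_diagonalGL]
    rfl
  · intro t
    exact ⟨transvectionGL t.i t.j t.hij t.c, rfl, 1, by rw [hT, map_one, map_one]⟩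
  · rintro A B - - ⟨gA, hA, dA, hdA⟩ ⟨gB, hB, dB, hdB⟩
    exact ⟨gA * gB, by rw [Units.val_mul, hA, hB], dA * dB, by rw [map_mul, hdA, hdB, ← map_mul, ← map_mul]⟩

omit [ValuativeRel F] [TopologicalSpace F] [IsNonarchimedeanLocalField F] in
/-- **All `ω(g)` commute** when every transvection acts trivially (the diagonal torus is abelian). [cite: BernsteinZelevinskyASENS1977, Thm. 4.7] -/
theorem apply_mul_apply_comm (hT : ∀ (i j : Fin 3) (hij : i ≠ j) (c : F), ω (transvectionGL i j hij c) = 1) (g h : GL (Fin 3) F) : ω g * ω h = ω h * ω g := by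
  obtain ⟨d, hd⟩ := exists_diagonalGL_apply_eq ω hT g
  obtain ⟨e, he⟩ := exists_diagonalGL_apply_eq ω hT h
  rw [hd, he, ← map_mul, ← map_mul, ← map_mul, ← map_mul, mul_comm]

end Transvections

/-! ## §2 The heads: `dim ω = 1`, `dim r_B ω = 1` -/

section Heads

variable [ω.IsIrreducible]

/-- **RULE (lev), SCALAR FORM**: for `ω` irreducible smooth on `GL₃(F)` with `ω_{U₃,ψ_nd} = 0` and `ω_{U₃,ψ′} = 0`, every `ω(g)` is a scalar (Schur in countable dimension
after §1–§2). [cite: BernsteinZelevinskyASENS1977, Thm. 4.7] [cite: BernsteinZelevinsky1976, 2.11] -/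
theorem exists_apply_eq_smul_id_of_degenerate (hψ : ψ.IsContinuousNontrivial) (hω : ω.IsSmooth) (hnd : ∀ v, Coinvariants.mk (whittakerTwist ω ψ) v = 0)
    (θ' : ↥(upperUnitriangular (Fin 3) F) →* ℂˣ) (hθ' : ∀ u, ((θ' u : ℂˣ) : ℂ) = ψ (((u : GL (Fin 3) F) : Matrix (Fin 3) (Fin 3) F) 1 2))
    (hdeg : ∀ v, Coinvariants.mk (ω.charTwist (upperUnitriangular (Fin 3) F) θ') v = 0) (g : GL (Fin 3) F) :
    ∃ c : ℂ, ω g = c • (LinearMap.id : V →ₗ[ℂ] V) := by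
  haveI : SigmaCompactSpace (GL (Fin 3) F) := sigmaCompactSpace_generalLinearGroup F 3
  have hnd' : Coinvariants.ker (whittakerTwist ω ψ) = ⊤ := eq_top_iff.2 fun v _ => (Coinvariants.mk_eq_zero _).1 (hnd v)
  have hdeg' : Coinvariants.ker (ω.charTwist (upperUnitriangular (Fin 3) F) θ') = ⊤ := eq_top_iff.2 fun v _ => (Coinvariants.mk_eq_zero _).1 (hdeg v)
  have hN : ∀ n ∈ unipotentRadicalGL F ![false, false, true], ∀ v : V, ω n v = v :=
    fun n hn v => apply_eq_self_of_mem_unipotentRadical21_of_degenerate ω hψ hω hnd' θ' hθ' hdeg' hn v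
  have hT : ∀ (i j : Fin 3) (hij : i ≠ j) (c : F), ω (transvectionGL i j hij c) = 1 :=
    fun i j hij c => LinearMap.ext fun v => apply_transvectionGL_eq_self ω hN hij c v
  have hG : ∀ U : Subgroup (GL (Fin 3) F), IsOpen (U : Set (GL (Fin 3) F)) → Countable (GL (Fin 3) F ⧸ U) :=
    fun U hU => countable_quotient_of_isOpen_of_sigmaCompactSpace U hU
  exact IsIrreducible.exists_eq_smul_id_of_rank_le_aleph0 (hω.rank_le_aleph0 hG) (ω g) fun h => by
    rw [← Module.End.mul_eq_comp, ← Module.End.mul_eq_comp, apply_mul_apply_comm ω hT]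

/-- **RULE (lev): A `ψ_nd`- AND `ψ′`-DEGENERATE IRREDUCIBLE SMOOTH REPRESENTATION OF `GL₃(F)` IS ONE-DIMENSIONAL.**  For `ω` irreducible smooth with `ω_{U₃,ψ_nd} = 0`
(`hnd`) and `ω_{U₃,ψ′} = 0` (`hdeg′`, `ψ′(u) = ψ(u₁₂)`): `Module.finrank ℂ V = 1` (every `ω(g)` is a scalar, so every subspace is invariant).
[cite: BernsteinZelevinskyASENS1977, Thm. 4.7] [cite: Zelevinsky1980, 4.3] -/
theorem finrank_eq_one_of_degenerate (hψ : ψ.IsContinuousNontrivial) (hω : ω.IsSmooth) (hnd : ∀ v, Coinvariants.mk (whittakerTwist ω ψ) v = 0)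
    (θ' : ↥(upperUnitriangular (Fin 3) F) →* ℂˣ) (hθ' : ∀ u, ((θ' u : ℂˣ) : ℂ) = ψ (((u : GL (Fin 3) F) : Matrix (Fin 3) (Fin 3) F) 1 2))
    (hdeg : ∀ v, Coinvariants.mk (ω.charTwist (upperUnitriangular (Fin 3) F) θ') v = 0) : Module.finrank ℂ V = 1 := by
  haveI : Nontrivial V := IsIrreducible.nontrivial ω
  have hscalar := exists_apply_eq_smul_id_of_degenerate ω hψ hω hnd θ' hθ' hdeg
  have hsimple : IsSimpleModule ℂ V :=
    { eq_bot_or_eq_top := fun W => by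
        let W' : Subrepresentation ω :=
          ⟨W, fun g v hv => by
            obtain ⟨c, hc⟩ := hscalar g
            rw [hc, LinearMap.smul_apply, LinearMap.id_apply]
            exact W.smul_mem c hv⟩
        rcases IsSimpleOrder.eq_bot_or_eq_top W' with h | h
        · exact Or.inl (congrArg Subrepresentation.toSubmodule h)
        · exact Or.inr (congrArg Subrepresentation.toSubmodule h) }
  exact isSimpleModule_iff_finrank_eq_one.1 hsimple

omit [ω.IsIrreducible] in
/-- **`U₃` acts trivially** on a `ψ_nd`- and `ψ′`-degenerate smooth representation (`U₃ = U_Q · U_{α₁}`, `U_Q` by ★ core, `U_{α₁} = {T₀₁(x)}` by §1).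
[cite: BernsteinZelevinskyASENS1977, Thm. 4.7] -/
theorem apply_eq_self_of_mem_upperUnitriangular_of_degenerate (hψ : ψ.IsContinuousNontrivial) (hω : ω.IsSmooth)
    (hnd : ∀ v, Coinvariants.mk (whittakerTwist ω ψ) v = 0)
    (θ' : ↥(upperUnitriangular (Fin 3) F) →* ℂˣ) (hθ' : ∀ u, ((θ' u : ℂˣ) : ℂ) = ψ (((u : GL (Fin 3) F) : Matrix (Fin 3) (Fin 3) F) 1 2))
    (hdeg : ∀ v, Coinvariants.mk (ω.charTwist (upperUnitriangular (Fin 3) F) θ') v = 0)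
    {u : GL (Fin 3) F} (hu : u ∈ upperUnitriangular (Fin 3) F) (v : V) : ω u v = v := by
  have hnd' : Coinvariants.ker (whittakerTwist ω ψ) = ⊤ := eq_top_iff.2 fun v _ => (Coinvariants.mk_eq_zero _).1 (hnd v)
  have hdeg' : Coinvariants.ker (ω.charTwist (upperUnitriangular (Fin 3) F) θ') = ⊤ := eq_top_iff.2 fun v _ => (Coinvariants.mk_eq_zero _).1 (hdeg v)
  have hN : ∀ n ∈ unipotentRadicalGL F ![false, false, true], ∀ v : V, ω n v = v :=
    fun n hn v => apply_eq_self_of_mem_unipotentRadical21_of_degenerate ω hψ hω hnd' θ' hθ' hdeg' hn v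
  obtain ⟨n, hn, h, hh, rfl⟩ := exists_mul_eq_of_mem_upperUnitriangular hu
  have e := eq_transvection_of_mem_rootGroup_fin_three h hh.1 hh.2
  have hh' : h = transvectionGL (0 : Fin 3) 1 (by decide) ((h : Matrix (Fin 3) (Fin 3) F) 0 1) := Units.ext (by rw [coe_transvectionGL]; exact e)
  rw [map_mul, Module.End.mul_apply, hh', apply_transvectionGL_eq_self ω hN, hN n hn]

omit [ω.IsIrreducible] in
/-- **The Borel Jacquet module of a degenerate representation is everything**: `V(U₃) = 0`, i.e. the kernel of `V → r_B(V)` (★ `restrictUnipotentGL F id`) is `⊥`.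
[cite: BernsteinZelevinskyASENS1977, Thm. 4.7] -/
theorem ker_restrictUnipotentGL_eq_bot_of_degenerate (hψ : ψ.IsContinuousNontrivial) (hω : ω.IsSmooth)
    (hnd : ∀ v, Coinvariants.mk (whittakerTwist ω ψ) v = 0)
    (θ' : ↥(upperUnitriangular (Fin 3) F) →* ℂˣ) (hθ' : ∀ u, ((θ' u : ℂˣ) : ℂ) = ψ (((u : GL (Fin 3) F) : Matrix (Fin 3) (Fin 3) F) 1 2))
    (hdeg : ∀ v, Coinvariants.mk (ω.charTwist (upperUnitriangular (Fin 3) F) θ') v = 0) :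
    Coinvariants.ker (restrictUnipotentGL F (id : Fin 3 → Fin 3) ω) = ⊥ := by
  refine (Submodule.eq_bot_iff _).2 fun x hx => ?_
  refine Submodule.span_induction (fun y hy => ?_) rfl (fun a b _ _ ha hb => by rw [ha, hb, add_zero]) (fun c a _ ha => by rw [ha, smul_zero]) hx
  obtain ⟨⟨u, v⟩, rfl⟩ := hy
  have hu : ((u : ↥(standardParabolicGL F (id : Fin 3 → Fin 3))) : GL (Fin 3) F) ∈ upperUnitriangular (Fin 3) F :=
    ⟨(u : ↥(standardParabolicGL F (id : Fin 3 → Fin 3))), u.2, rfl⟩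
  show ω ((u : ↥(standardParabolicGL F (id : Fin 3 → Fin 3))) : GL (Fin 3) F) v - v = 0
  rw [apply_eq_self_of_mem_upperUnitriangular_of_degenerate ω hψ hω hnd θ' hθ' hdeg hu, sub_self]

/-- **RULE (lev), JACQUET FORM: `dim r_B(ω) = 1`** for `ω` irreducible smooth on `GL₃(F)` with `ω_{U₃,ψ_nd} = 0` and `ω_{U₃,ψ′} = 0` (the Borel Jacquet module
`(restrictUnipotentGL F id ω).Coinvariants` of ★ `jacquetGL` is `V ⧸ 0 ≅ V`, a line). [cite: BernsteinZelevinskyASENS1977, Thm. 4.7] [cite: Zelevinsky1980, 4.3] -/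
theorem finrank_coinvariants_restrictUnipotentGL_eq_one_of_degenerate (hψ : ψ.IsContinuousNontrivial) (hω : ω.IsSmooth)
    (hnd : ∀ v, Coinvariants.mk (whittakerTwist ω ψ) v = 0)
    (θ' : ↥(upperUnitriangular (Fin 3) F) →* ℂˣ) (hθ' : ∀ u, ((θ' u : ℂˣ) : ℂ) = ψ (((u : GL (Fin 3) F) : Matrix (Fin 3) (Fin 3) F) 1 2))
    (hdeg : ∀ v, Coinvariants.mk (ω.charTwist (upperUnitriangular (Fin 3) F) θ') v = 0) :
    Module.finrank ℂ (restrictUnipotentGL F (id : Fin 3 → Fin 3) ω).Coinvariants = 1 := by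
  have hbot := ker_restrictUnipotentGL_eq_bot_of_degenerate ω hψ hω hnd θ' hθ' hdeg
  have e : (restrictUnipotentGL F (id : Fin 3 → Fin 3) ω).Coinvariants ≃ₗ[ℂ] V :=
    (Submodule.quotEquivOfEqBot _ hbot)
  rw [e.finrank_eq, finrank_eq_one_of_degenerate ω hψ hω hnd θ' hθ' hdeg]

end Heads

end Summit.HodgeConjecture.HodgeConjecture.Cruxes.H413.K2E3GL3DegenerateLevelOne

end
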